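import Summits.Ventures.HSemireg.WeilFrameLeadingTermEulerPin
import Summits.Ventures.HSemireg.Mod4IdealShapePinZeroOdd
import Summits.Ventures.HSemireg.Mod4IdealShapeHankelRank

/-!
# Venture HSemireg — TABLE R's «1 − ch(O_Z)» (I_Z-SHAPE) ROW ON THE REAL CARRIER OF A WEIL `(4c+2)`-FOLD (ODD `n`) AT THE EXTREME
# PIN `t_0 = −q_n²`: middle entry `(r_n + 2)C(2n,n) − 2r_n − 2·[det B⁻ = 0]` and Euler-pin value `e_n + 2·[det B⁻ = 0]`

HONEST FRAMING. Part of the Lean index of the computation cell `pub-hsemireg` (seat w3-mod4-1 gen 15, W3 SPECIAL FIBRES;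
MOD4-OFFSPLIT §13.39–13.40). The tree's real carriers and the Literature's Weil-type layer ONLY: no semiregularity map, no Ext group,
no `∫`, no HRR; nothing here says that HC / HC_CM / HC_AV holds; nothing here is a claim about any explicit variety or cycle; no
Literature fact is declared; NO definition is introduced. Imports: FILE 46 `WeilFrameLeadingTermEulerPin` (row identity + side
degrees, which allow `q_0 ≠ 0`), FILE 62 `Mod4IdealShapePinZeroOdd`, FILE 57 `Mod4IdealShapeHankelRank`.

WHAT IS PROVED, for `A : AbelianVariety ℂ` of dimension `2n`, `n = k + 1` ODD, `k ≥ 1`, with the Weil-type hypotheses of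
`finrank_S_weilType_middle`, the class `x = Σ_{m ≤ 2n} (q_m/m!) ĥ^m + ĉ₊ + ĉ₋` of `I_Z` SHAPE (`q_0 ≠ 0`, `q_m = 0` for `1 ≤ m < n`,
`q_n ≠ 0`, ANY tail), the pin `(2n)!·(ĉ₊ĉ₋) = t·ĥ^{2n}` with `t = (−1)ⁿ q_n² = −q_n²`, a regular Hankel square `Hsq = (q_{i+j})_{i,j≤n}`
(`r_n = n + 1`), and `B⁻` the `n × n` block of `T_f(q⁰) − q_n` (`q⁰ = q[0 ↦ 0]`):
* **`finrank_S_idealShape_middle_pinZero_odd_of_ne`** — `det B⁻ ≠ 0` ⇒ `dim S_n(x) + 2(n+1) = (n+3)·C(2n,n)` (NO drop; `n = 3`: `112`);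
* **`finrank_S_idealShape_middle_pinZero_odd_of_eq`** — `det B⁻ = 0` ⇒ `dim S_n(x) + 2(n+1) + 2 = (n+3)·C(2n,n)` (`n = 3`: `110`);
* **`finrank_S_idealShape_middle_pinZero_odd_hankelDeg_of_ne ∕ _of_eq`** — the same with a DEGENERATE Hankel square (`r_n = n`):
  `dim S_n(x) + 2n + 2·[det B⁻ = 0] = (n+2)·C(2n,n)`;
* **`eulerSum_idealShape_pinZero_odd_of_ne ∕ _of_eq`** — `Σ_{k ≤ 2n}(−1)^k dim S_k(x) = (−1)ⁿ(2C(2n−2,n−1) + 2n + 2 − δ)`, `δ = 0 ∕ 2`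
  (`n = 3`: `−20 ∕ −18`; the `O_Z` row reads `−18` at every tail, FILE 46).
READING: on a Weil `(4c+2)`-fold the `I_Z` row at the `[Z]²`-pin generically shows NO drop where the `O_Z` row always drops `2`.
Everything PROVED, 0 sorry.
References: [BuchweitzFlenner2008HH] Prop. 6.4.4; [vanGeemen1994HodgeAV] 4.9, Lemma 5.2; [BourbakiAlgebre1a3] Ch. III §8, §11 no. 9.
-/

noncomputable section

open CliffordAlgebra (contractLeft)
open ExteriorAlgebra (ι)
open Module CategoryTheory
open Literature.AlgebraicGeometry.Motives Literature.AlgebraicGeometry.HodgeTheory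
open Literature.AlgebraicTopology.SingularHomology

namespace Summit.Ventures.HSemireg.WeilFrame

open Summit.Ventures.HSemireg.WedgeBridge Summit.Ventures.HSemireg.WeilCarrier Summit.Ventures.HSemireg.Mod4Carrier
open Summit.Ventures.HSemireg.Wedge.Hankel

section RealCarrier

variable {A : AbelianVariety ℂ}

/-- **`I_Z` row, ODD `n = k + 1`, extreme pin, regular Hankel square, `det B⁻ ≠ 0` ⇒ NO DROP:** `dim S_n(x) + 2(n+1) = (n+3)·C(2n,n)`.
[cite: BuchweitzFlenner2008HH, Prop. 6.4.4] [cite: vanGeemen1994HodgeAV, 4.9 and Lemma 5.2] -/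
theorem finrank_S_idealShape_middle_pinZero_odd_of_ne (hA : IsSmoothProjective A.dim A.X) {n k d : ℕ} (hnk : n = k + 1) (hk : 1 ≤ k) (hodd : Odd n)
    (hdim : A.dim = n + n) (hd : 0 < d)
    {φ : A ⟶ A} (hφ : φ ≫ φ = -(d • 𝟙 A)) {P Q : Submodule ℂ (complexBetti A.X 1)}
    (hP : P = Module.End.eigenspace (complexBetti.map φ.hom.hom.hom 1).hom (Complex.I * (Real.sqrt d : ℂ)))
    (hQ : Q = Module.End.eigenspace (complexBetti.map φ.hom.hom.hom 1).hom (-(Complex.I * (Real.sqrt d : ℂ))))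
    (hp : finrank ℂ ↥(P ⊓ hodgeOneZero hA) = n) {h : complexBetti A.X 2}
    (hh : complexBetti.map φ.hom.hom.hom 2 h = (d : ℂ) • h) (h11 : IsOfHodgeType A.dim A.X 2 1 1 h)
    (hvol : ((⋀[ℂ]^2 (complexBetti A.X 1)).subtype ((abelianVarietyCohomologyExteriorH1_holds.equiv A 2).symm h)) ^ (n + n) ≠ 0)
    {cP cQ : complexBetti A.X (2 * n)} (hcP : cP ∈ weilClassesPlus A φ n d) (hcP0 : cP ≠ 0)
    (hcQ : cQ ∈ weilClassesMinus A φ n d) (hcQ0 : cQ ≠ 0)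
    {q : ℕ → ℂ} (hq : ∀ m, 1 ≤ m → m < n → q m = 0) (hq0 : q 0 ≠ 0) (hqn : q n ≠ 0) {t : ℂ}
    (ht : (((n + n).factorial : ℕ) : ℂ) •
        ((⋀[ℂ]^(2 * n) (complexBetti A.X 1)).subtype ((abelianVarietyCohomologyExteriorH1_holds.equiv A (2 * n)).symm cP) *
          (⋀[ℂ]^(2 * n) (complexBetti A.X 1)).subtype ((abelianVarietyCohomologyExteriorH1_holds.equiv A (2 * n)).symm cQ)) =
      t • ((⋀[ℂ]^2 (complexBetti A.X 1)).subtype ((abelianVarietyCohomologyExteriorH1_holds.equiv A 2).symm h)) ^ (n + n))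
    (hpin : t = (-1 : ℂ) ^ n * (q n * q n)) {B : Matrix (Fin n) (Fin n) ℂ}
    (hB : B = Matrix.of fun r s : Fin n =>
      (Mod4.hankelT n (Function.update q 0 0) - q n • (1 : Matrix (Fin (n + 1)) (Fin (n + 1)) ℂ)) ⟨0 + r, by omega⟩
        ⟨0 + 1 + s, by omega⟩)
    {Hsq : Matrix (Fin (n + 1)) (Fin (n + 1)) ℂ} (hHsq : Hsq = Matrix.of fun i j : Fin (n + 1) => q ((i : ℕ) + (j : ℕ)))
    (hH : Hsq.det ≠ 0) (hdet : B.det ≠ 0) :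
    finrank ℂ ↥(S ℂ (hodgeZeroOne hA) n
        ((∑ m ∈ Finset.range (n + n + 1), (q m * ((m.factorial : ℕ) : ℂ)⁻¹) •
            ((⋀[ℂ]^2 (complexBetti A.X 1)).subtype ((abelianVarietyCohomologyExteriorH1_holds.equiv A 2).symm h)) ^ m) +
          (⋀[ℂ]^(2 * n) (complexBetti A.X 1)).subtype ((abelianVarietyCohomologyExteriorH1_holds.equiv A (2 * n)).symm cP) +
          (⋀[ℂ]^(2 * n) (complexBetti A.X 1)).subtype ((abelianVarietyCohomologyExteriorH1_holds.equiv A (2 * n)).symm cQ))) +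
        2 * (n + 1) = (n + 3) * (n + n).choose n := by
  haveI : Module.Finite ℂ (complexBetti A.X 1) := abelianVarietyCohomologyExteriorH1_holds.finite_one A
  have h := finrank_S_weilType_middle hA hdim hd hφ hP hQ hp hh h11 hvol hcP hcP0 hcQ hcQ0 (by omega) q ht
  subst hnk
  rw [Mod4.hankel1_rank_idealShape_of_det_ne_zero (k + 1) q hHsq hH,
    Mod4.finrank_ker_middleM_idealShape_pin_zero_odd_of_ne hk hodd hq hq0 hqn hpin hB hdet] at h
  have e : (k + 1 + 1 + 2) * (k + 1 + (k + 1)).choose (k + 1) = (k + 1 + 3) * (k + 1 + (k + 1)).choose (k + 1) := by ring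
  omega

/-- **`I_Z` row, ODD `n = k + 1`, extreme pin, regular Hankel square, `det B⁻ = 0` ⇒ DROP `2`:** `dim S_n(x) + 2(n+1) + 2 = (n+3)·C(2n,n)`.
[cite: BuchweitzFlenner2008HH, Prop. 6.4.4] [cite: vanGeemen1994HodgeAV, 4.9 and Lemma 5.2] -/
theorem finrank_S_idealShape_middle_pinZero_odd_of_eq (hA : IsSmoothProjective A.dim A.X) {n k d : ℕ} (hnk : n = k + 1) (hk : 1 ≤ k) (hodd : Odd n)
    (hdim : A.dim = n + n) (hd : 0 < d)
    {φ : A ⟶ A} (hφ : φ ≫ φ = -(d • 𝟙 A)) {P Q : Submodule ℂ (complexBetti A.X 1)}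
    (hP : P = Module.End.eigenspace (complexBetti.map φ.hom.hom.hom 1).hom (Complex.I * (Real.sqrt d : ℂ)))
    (hQ : Q = Module.End.eigenspace (complexBetti.map φ.hom.hom.hom 1).hom (-(Complex.I * (Real.sqrt d : ℂ))))
    (hp : finrank ℂ ↥(P ⊓ hodgeOneZero hA) = n) {h : complexBetti A.X 2}
    (hh : complexBetti.map φ.hom.hom.hom 2 h = (d : ℂ) • h) (h11 : IsOfHodgeType A.dim A.X 2 1 1 h)
    (hvol : ((⋀[ℂ]^2 (complexBetti A.X 1)).subtype ((abelianVarietyCohomologyExteriorH1_holds.equiv A 2).symm h)) ^ (n + n) ≠ 0)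
    {cP cQ : complexBetti A.X (2 * n)} (hcP : cP ∈ weilClassesPlus A φ n d) (hcP0 : cP ≠ 0)
    (hcQ : cQ ∈ weilClassesMinus A φ n d) (hcQ0 : cQ ≠ 0)
    {q : ℕ → ℂ} (hq : ∀ m, 1 ≤ m → m < n → q m = 0) (hq0 : q 0 ≠ 0) (hqn : q n ≠ 0) {t : ℂ}
    (ht : (((n + n).factorial : ℕ) : ℂ) •
        ((⋀[ℂ]^(2 * n) (complexBetti A.X 1)).subtype ((abelianVarietyCohomologyExteriorH1_holds.equiv A (2 * n)).symm cP) *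
          (⋀[ℂ]^(2 * n) (complexBetti A.X 1)).subtype ((abelianVarietyCohomologyExteriorH1_holds.equiv A (2 * n)).symm cQ)) =
      t • ((⋀[ℂ]^2 (complexBetti A.X 1)).subtype ((abelianVarietyCohomologyExteriorH1_holds.equiv A 2).symm h)) ^ (n + n))
    (hpin : t = (-1 : ℂ) ^ n * (q n * q n)) {B : Matrix (Fin n) (Fin n) ℂ}
    (hB : B = Matrix.of fun r s : Fin n =>
      (Mod4.hankelT n (Function.update q 0 0) - q n • (1 : Matrix (Fin (n + 1)) (Fin (n + 1)) ℂ)) ⟨0 + r, by omega⟩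
        ⟨0 + 1 + s, by omega⟩)
    {Hsq : Matrix (Fin (n + 1)) (Fin (n + 1)) ℂ} (hHsq : Hsq = Matrix.of fun i j : Fin (n + 1) => q ((i : ℕ) + (j : ℕ)))
    (hH : Hsq.det ≠ 0) (hdet : B.det = 0) :
    finrank ℂ ↥(S ℂ (hodgeZeroOne hA) n
        ((∑ m ∈ Finset.range (n + n + 1), (q m * ((m.factorial : ℕ) : ℂ)⁻¹) •
            ((⋀[ℂ]^2 (complexBetti A.X 1)).subtype ((abelianVarietyCohomologyExteriorH1_holds.equiv A 2).symm h)) ^ m) +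
          (⋀[ℂ]^(2 * n) (complexBetti A.X 1)).subtype ((abelianVarietyCohomologyExteriorH1_holds.equiv A (2 * n)).symm cP) +
          (⋀[ℂ]^(2 * n) (complexBetti A.X 1)).subtype ((abelianVarietyCohomologyExteriorH1_holds.equiv A (2 * n)).symm cQ))) +
        2 * (n + 1) + 2 = (n + 3) * (n + n).choose n := by
  haveI : Module.Finite ℂ (complexBetti A.X 1) := abelianVarietyCohomologyExteriorH1_holds.finite_one A
  have h := finrank_S_weilType_middle hA hdim hd hφ hP hQ hp hh h11 hvol hcP hcP0 hcQ hcQ0 (by omega) q ht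
  subst hnk
  rw [Mod4.hankel1_rank_idealShape_of_det_ne_zero (k + 1) q hHsq hH,
    Mod4.finrank_ker_middleM_idealShape_pin_zero_odd_of_eq hk hodd hq hq0 hqn hpin hB hdet] at h
  have e : (k + 1 + 1 + 2) * (k + 1 + (k + 1)).choose (k + 1) = (k + 1 + 3) * (k + 1 + (k + 1)).choose (k + 1) := by ring
  omega

/-- **`I_Z` row, ODD `n = k + 1`, extreme pin, DEGENERATE Hankel square (`det Hsq = 0`, `r_n = n`), `det B⁻ ≠ 0`:** `dim S_n(x) + 2n = (n+2)·C(2n,n)`.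
[cite: BuchweitzFlenner2008HH, Prop. 6.4.4] [cite: vanGeemen1994HodgeAV, 4.9 and Lemma 5.2] -/
theorem finrank_S_idealShape_middle_pinZero_odd_hankelDeg_of_ne (hA : IsSmoothProjective A.dim A.X) {n k d : ℕ} (hnk : n = k + 1) (hk : 1 ≤ k) (hodd : Odd n)
    (hdim : A.dim = n + n) (hd : 0 < d)
    {φ : A ⟶ A} (hφ : φ ≫ φ = -(d • 𝟙 A)) {P Q : Submodule ℂ (complexBetti A.X 1)}
    (hP : P = Module.End.eigenspace (complexBetti.map φ.hom.hom.hom 1).hom (Complex.I * (Real.sqrt d : ℂ)))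
    (hQ : Q = Module.End.eigenspace (complexBetti.map φ.hom.hom.hom 1).hom (-(Complex.I * (Real.sqrt d : ℂ))))
    (hp : finrank ℂ ↥(P ⊓ hodgeOneZero hA) = n) {h : complexBetti A.X 2}
    (hh : complexBetti.map φ.hom.hom.hom 2 h = (d : ℂ) • h) (h11 : IsOfHodgeType A.dim A.X 2 1 1 h)
    (hvol : ((⋀[ℂ]^2 (complexBetti A.X 1)).subtype ((abelianVarietyCohomologyExteriorH1_holds.equiv A 2).symm h)) ^ (n + n) ≠ 0)
    {cP cQ : complexBetti A.X (2 * n)} (hcP : cP ∈ weilClassesPlus A φ n d) (hcP0 : cP ≠ 0)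
    (hcQ : cQ ∈ weilClassesMinus A φ n d) (hcQ0 : cQ ≠ 0)
    {q : ℕ → ℂ} (hq : ∀ m, 1 ≤ m → m < n → q m = 0) (hq0 : q 0 ≠ 0) (hqn : q n ≠ 0) {t : ℂ}
    (ht : (((n + n).factorial : ℕ) : ℂ) •
        ((⋀[ℂ]^(2 * n) (complexBetti A.X 1)).subtype ((abelianVarietyCohomologyExteriorH1_holds.equiv A (2 * n)).symm cP) *
          (⋀[ℂ]^(2 * n) (complexBetti A.X 1)).subtype ((abelianVarietyCohomologyExteriorH1_holds.equiv A (2 * n)).symm cQ)) =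
      t • ((⋀[ℂ]^2 (complexBetti A.X 1)).subtype ((abelianVarietyCohomologyExteriorH1_holds.equiv A 2).symm h)) ^ (n + n))
    (hpin : t = (-1 : ℂ) ^ n * (q n * q n)) {B : Matrix (Fin n) (Fin n) ℂ}
    (hB : B = Matrix.of fun r s : Fin n =>
      (Mod4.hankelT n (Function.update q 0 0) - q n • (1 : Matrix (Fin (n + 1)) (Fin (n + 1)) ℂ)) ⟨0 + r, by omega⟩
        ⟨0 + 1 + s, by omega⟩)
    {Hsq : Matrix (Fin (n + 1)) (Fin (n + 1)) ℂ} (hHsq : Hsq = Matrix.of fun i j : Fin (n + 1) => q ((i : ℕ) + (j : ℕ)))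
    (hH : Hsq.det = 0) (hdet : B.det ≠ 0) :
    finrank ℂ ↥(S ℂ (hodgeZeroOne hA) n
        ((∑ m ∈ Finset.range (n + n + 1), (q m * ((m.factorial : ℕ) : ℂ)⁻¹) •
            ((⋀[ℂ]^2 (complexBetti A.X 1)).subtype ((abelianVarietyCohomologyExteriorH1_holds.equiv A 2).symm h)) ^ m) +
          (⋀[ℂ]^(2 * n) (complexBetti A.X 1)).subtype ((abelianVarietyCohomologyExteriorH1_holds.equiv A (2 * n)).symm cP) +
          (⋀[ℂ]^(2 * n) (complexBetti A.X 1)).subtype ((abelianVarietyCohomologyExteriorH1_holds.equiv A (2 * n)).symm cQ))) +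
        2 * n = (n + 2) * (n + n).choose n := by
  haveI : Module.Finite ℂ (complexBetti A.X 1) := abelianVarietyCohomologyExteriorH1_holds.finite_one A
  have h := finrank_S_weilType_middle hA hdim hd hφ hP hQ hp hh h11 hvol hcP hcP0 hcQ hcQ0 (by omega) q ht
  subst hnk
  rw [Mod4.hankel1_rank_idealShape_of_det_eq_zero hq hqn hHsq hH,
    Mod4.finrank_ker_middleM_idealShape_pin_zero_odd_of_ne hk hodd hq hq0 hqn hpin hB hdet] at h
  omega

/-- **`I_Z` row, ODD `n = k + 1`, extreme pin, DEGENERATE Hankel square (`det Hsq = 0`, `r_n = n`), `det B⁻ = 0`:** `dim S_n(x) + 2n + 2 = (n+2)·C(2n,n)`.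
[cite: BuchweitzFlenner2008HH, Prop. 6.4.4] [cite: vanGeemen1994HodgeAV, 4.9 and Lemma 5.2] -/
theorem finrank_S_idealShape_middle_pinZero_odd_hankelDeg_of_eq (hA : IsSmoothProjective A.dim A.X) {n k d : ℕ} (hnk : n = k + 1) (hk : 1 ≤ k) (hodd : Odd n)
    (hdim : A.dim = n + n) (hd : 0 < d)
    {φ : A ⟶ A} (hφ : φ ≫ φ = -(d • 𝟙 A)) {P Q : Submodule ℂ (complexBetti A.X 1)}
    (hP : P = Module.End.eigenspace (complexBetti.map φ.hom.hom.hom 1).hom (Complex.I * (Real.sqrt d : ℂ)))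
    (hQ : Q = Module.End.eigenspace (complexBetti.map φ.hom.hom.hom 1).hom (-(Complex.I * (Real.sqrt d : ℂ))))
    (hp : finrank ℂ ↥(P ⊓ hodgeOneZero hA) = n) {h : complexBetti A.X 2}
    (hh : complexBetti.map φ.hom.hom.hom 2 h = (d : ℂ) • h) (h11 : IsOfHodgeType A.dim A.X 2 1 1 h)
    (hvol : ((⋀[ℂ]^2 (complexBetti A.X 1)).subtype ((abelianVarietyCohomologyExteriorH1_holds.equiv A 2).symm h)) ^ (n + n) ≠ 0)
    {cP cQ : complexBetti A.X (2 * n)} (hcP : cP ∈ weilClassesPlus A φ n d) (hcP0 : cP ≠ 0)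
    (hcQ : cQ ∈ weilClassesMinus A φ n d) (hcQ0 : cQ ≠ 0)
    {q : ℕ → ℂ} (hq : ∀ m, 1 ≤ m → m < n → q m = 0) (hq0 : q 0 ≠ 0) (hqn : q n ≠ 0) {t : ℂ}
    (ht : (((n + n).factorial : ℕ) : ℂ) •
        ((⋀[ℂ]^(2 * n) (complexBetti A.X 1)).subtype ((abelianVarietyCohomologyExteriorH1_holds.equiv A (2 * n)).symm cP) *
          (⋀[ℂ]^(2 * n) (complexBetti A.X 1)).subtype ((abelianVarietyCohomologyExteriorH1_holds.equiv A (2 * n)).symm cQ)) =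
      t • ((⋀[ℂ]^2 (complexBetti A.X 1)).subtype ((abelianVarietyCohomologyExteriorH1_holds.equiv A 2).symm h)) ^ (n + n))
    (hpin : t = (-1 : ℂ) ^ n * (q n * q n)) {B : Matrix (Fin n) (Fin n) ℂ}
    (hB : B = Matrix.of fun r s : Fin n =>
      (Mod4.hankelT n (Function.update q 0 0) - q n • (1 : Matrix (Fin (n + 1)) (Fin (n + 1)) ℂ)) ⟨0 + r, by omega⟩
        ⟨0 + 1 + s, by omega⟩)
    {Hsq : Matrix (Fin (n + 1)) (Fin (n + 1)) ℂ} (hHsq : Hsq = Matrix.of fun i j : Fin (n + 1) => q ((i : ℕ) + (j : ℕ)))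
    (hH : Hsq.det = 0) (hdet : B.det = 0) :
    finrank ℂ ↥(S ℂ (hodgeZeroOne hA) n
        ((∑ m ∈ Finset.range (n + n + 1), (q m * ((m.factorial : ℕ) : ℂ)⁻¹) •
            ((⋀[ℂ]^2 (complexBetti A.X 1)).subtype ((abelianVarietyCohomologyExteriorH1_holds.equiv A 2).symm h)) ^ m) +
          (⋀[ℂ]^(2 * n) (complexBetti A.X 1)).subtype ((abelianVarietyCohomologyExteriorH1_holds.equiv A (2 * n)).symm cP) +
          (⋀[ℂ]^(2 * n) (complexBetti A.X 1)).subtype ((abelianVarietyCohomologyExteriorH1_holds.equiv A (2 * n)).symm cQ))) +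
        2 * n + 2 = (n + 2) * (n + n).choose n := by
  haveI : Module.Finite ℂ (complexBetti A.X 1) := abelianVarietyCohomologyExteriorH1_holds.finite_one A
  have h := finrank_S_weilType_middle hA hdim hd hφ hP hQ hp hh h11 hvol hcP hcP0 hcQ hcQ0 (by omega) q ht
  subst hnk
  rw [Mod4.hankel1_rank_idealShape_of_det_eq_zero hq hqn hHsq hH,
    Mod4.finrank_ker_middleM_idealShape_pin_zero_odd_of_eq hk hodd hq hq0 hqn hpin hB hdet] at h
  omega

/-- **`I_Z` row, ODD `n = k + 1 ≥ 3`, Euler-pin value at the extreme pin, regular Hankel square, `det B⁻ = 0`:**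
`Σ_{k ≤ 2n} (−1)^k dim S_k(x) = (−1)ⁿ (2C(2n−2,n−1) + 2n)` (`= e_n + 2` for odd `n`; `n = 3`: `−18`). [cite: BuchweitzFlenner2008HH, Prop. 6.4.4]
[cite: vanGeemen1994HodgeAV, 4.9 and Lemma 5.2] -/
theorem eulerSum_idealShape_pinZero_odd_of_eq (hA : IsSmoothProjective A.dim A.X) {n d : ℕ} (hdim : A.dim = n + n) (hd : 0 < d)
    {φ : A ⟶ A} (hφ : φ ≫ φ = -(d • 𝟙 A)) {P Q : Submodule ℂ (complexBetti A.X 1)}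
    (hP : P = Module.End.eigenspace (complexBetti.map φ.hom.hom.hom 1).hom (Complex.I * (Real.sqrt d : ℂ)))
    (hQ : Q = Module.End.eigenspace (complexBetti.map φ.hom.hom.hom 1).hom (-(Complex.I * (Real.sqrt d : ℂ))))
    (hp : finrank ℂ ↥(P ⊓ hodgeOneZero hA) = n) {h : complexBetti A.X 2}
    (hh : complexBetti.map φ.hom.hom.hom 2 h = (d : ℂ) • h) (h11 : IsOfHodgeType A.dim A.X 2 1 1 h)
    (hvol : ((⋀[ℂ]^2 (complexBetti A.X 1)).subtype ((abelianVarietyCohomologyExteriorH1_holds.equiv A 2).symm h)) ^ (n + n) ≠ 0)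
    {cP cQ : complexBetti A.X (2 * n)} (hcP : cP ∈ weilClassesPlus A φ n d) (hcP0 : cP ≠ 0)
    (hcQ : cQ ∈ weilClassesMinus A φ n d) (hcQ0 : cQ ≠ 0)
    {q : ℕ → ℂ} (hq : ∀ m, 1 ≤ m → m < n → q m = 0) (hq0 : q 0 ≠ 0) (hqn : q n ≠ 0) {t : ℂ}
    (ht : (((n + n).factorial : ℕ) : ℂ) •
        ((⋀[ℂ]^(2 * n) (complexBetti A.X 1)).subtype ((abelianVarietyCohomologyExteriorH1_holds.equiv A (2 * n)).symm cP) *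
          (⋀[ℂ]^(2 * n) (complexBetti A.X 1)).subtype ((abelianVarietyCohomologyExteriorH1_holds.equiv A (2 * n)).symm cQ)) =
      t • ((⋀[ℂ]^2 (complexBetti A.X 1)).subtype ((abelianVarietyCohomologyExteriorH1_holds.equiv A 2).symm h)) ^ (n + n))
    {k : ℕ} (hnk : n = k + 1) (hk : 2 ≤ k) (hodd : Odd n) (hpin : t = (-1 : ℂ) ^ n * (q n * q n))
    {B : Matrix (Fin n) (Fin n) ℂ}
    (hB : B = Matrix.of fun r s : Fin n =>
      (Mod4.hankelT n (Function.update q 0 0) - q n • (1 : Matrix (Fin (n + 1)) (Fin (n + 1)) ℂ)) ⟨0 + r, by omega⟩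
        ⟨0 + 1 + s, by omega⟩)
    {Hsq : Matrix (Fin (n + 1)) (Fin (n + 1)) ℂ} (hHsq : Hsq = Matrix.of fun i j : Fin (n + 1) => q ((i : ℕ) + (j : ℕ)))
    (hH : Hsq.det ≠ 0)
    (hdet : B.det = 0) :
    (∑ k ∈ Finset.range (n + n + 1), (-1 : ℤ) ^ k * (finrank ℂ ↥(S ℂ (hodgeZeroOne hA) k
        ((∑ m ∈ Finset.range (n + n + 1), (q m * ((m.factorial : ℕ) : ℂ)⁻¹) •
            ((⋀[ℂ]^2 (complexBetti A.X 1)).subtype ((abelianVarietyCohomologyExteriorH1_holds.equiv A 2).symm h)) ^ m) +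
          (⋀[ℂ]^(2 * n) (complexBetti A.X 1)).subtype ((abelianVarietyCohomologyExteriorH1_holds.equiv A (2 * n)).symm cP) +
          (⋀[ℂ]^(2 * n) (complexBetti A.X 1)).subtype ((abelianVarietyCohomologyExteriorH1_holds.equiv A (2 * n)).symm cQ))) : ℤ)) =
      (-1 : ℤ) ^ n * (2 * ((n + n - 2).choose (n - 1) : ℤ) + 2 * n + 2 - 2) := by
  haveI : Module.Finite ℂ (complexBetti A.X 1) := abelianVarietyCohomologyExteriorH1_holds.finite_one A
  have hn : 2 ≤ n := by omega
  have hq0' : ∀ m, 1 ≤ m → m < n → q m = 0 := hq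
  rw [show (2 * ((n + n - 2).choose (n - 1) : ℤ) + 2 * n + 2 - 2) = 2 * ((n + n - 2).choose (n - 1) : ℤ) + 2 * n + 2 - ((2 : ℕ) : ℤ)
    by push_cast; ring]
  have hn1 : 1 ≤ n := by omega
  have h0 := finrank_S_weilType_zero hA hdim hd hφ hP hQ hp hh h11 hvol hcP hcP0 hcQ hcQ0 hn1 q
  have htop := finrank_S_weilType_top hA hdim hd hφ hP hQ hp hh h11 hvol hcP hcP0 hcQ hcQ0 hn1 q
  refine alternating_sum_leading_row hn _ _ ?_ ?_ ?_
  · intro k hk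
    rcases Nat.eq_zero_or_pos k with rfl | hk1
    · rw [h0, Nat.choose_zero_right, Nat.choose_zero_right]
    · exact finrank_S_leading_deg hA hdim hd hφ hP hQ hp hh h11 hvol hcP hcP0 hcQ hcQ0 hq0' hqn hk1 hk
  · intro k hk
    rcases Nat.eq_zero_or_pos k with rfl | hk1
    · rw [Nat.sub_zero, htop, Nat.choose_zero_right, Nat.choose_zero_right]
    · exact finrank_S_leading_deg_dual hA hdim hd hφ hP hQ hp hh h11 hvol hcP hcP0 hcQ hcQ0 hq0' hqn (k := n + n - k)
        (k' := k) hk1 hk (by omega)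
  · exact finrank_S_idealShape_middle_pinZero_odd_of_eq hA hnk (by omega) hodd hdim hd hφ hP hQ hp hh h11 hvol hcP hcP0 hcQ
      hcQ0 hq hq0 hqn ht hpin hB hHsq hH hdet

/-- **`I_Z` row, ODD `n = k + 1 ≥ 3`, Euler-pin value at the extreme pin, regular Hankel square, `det B⁻ ≠ 0`:**
`Σ_{k ≤ 2n} (−1)^k dim S_k(x) = (−1)ⁿ (2C(2n−2,n−1) + 2n + 2) = e_n` — NO drop (`n = 3`: `−20`, where the `O_Z` row reads `−18`).
[cite: BuchweitzFlenner2008HH, Prop. 6.4.4] [cite: vanGeemen1994HodgeAV, 4.9 and Lemma 5.2] -/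
theorem eulerSum_idealShape_pinZero_odd_of_ne (hA : IsSmoothProjective A.dim A.X) {n d : ℕ} (hdim : A.dim = n + n) (hd : 0 < d)
    {φ : A ⟶ A} (hφ : φ ≫ φ = -(d • 𝟙 A)) {P Q : Submodule ℂ (complexBetti A.X 1)}
    (hP : P = Module.End.eigenspace (complexBetti.map φ.hom.hom.hom 1).hom (Complex.I * (Real.sqrt d : ℂ)))
    (hQ : Q = Module.End.eigenspace (complexBetti.map φ.hom.hom.hom 1).hom (-(Complex.I * (Real.sqrt d : ℂ))))
    (hp : finrank ℂ ↥(P ⊓ hodgeOneZero hA) = n) {h : complexBetti A.X 2}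
    (hh : complexBetti.map φ.hom.hom.hom 2 h = (d : ℂ) • h) (h11 : IsOfHodgeType A.dim A.X 2 1 1 h)
    (hvol : ((⋀[ℂ]^2 (complexBetti A.X 1)).subtype ((abelianVarietyCohomologyExteriorH1_holds.equiv A 2).symm h)) ^ (n + n) ≠ 0)
    {cP cQ : complexBetti A.X (2 * n)} (hcP : cP ∈ weilClassesPlus A φ n d) (hcP0 : cP ≠ 0)
    (hcQ : cQ ∈ weilClassesMinus A φ n d) (hcQ0 : cQ ≠ 0)
    {q : ℕ → ℂ} (hq : ∀ m, 1 ≤ m → m < n → q m = 0) (hq0 : q 0 ≠ 0) (hqn : q n ≠ 0) {t : ℂ}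
    (ht : (((n + n).factorial : ℕ) : ℂ) •
        ((⋀[ℂ]^(2 * n) (complexBetti A.X 1)).subtype ((abelianVarietyCohomologyExteriorH1_holds.equiv A (2 * n)).symm cP) *
          (⋀[ℂ]^(2 * n) (complexBetti A.X 1)).subtype ((abelianVarietyCohomologyExteriorH1_holds.equiv A (2 * n)).symm cQ)) =
      t • ((⋀[ℂ]^2 (complexBetti A.X 1)).subtype ((abelianVarietyCohomologyExteriorH1_holds.equiv A 2).symm h)) ^ (n + n))
    {k : ℕ} (hnk : n = k + 1) (hk : 2 ≤ k) (hodd : Odd n) (hpin : t = (-1 : ℂ) ^ n * (q n * q n))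
    {B : Matrix (Fin n) (Fin n) ℂ}
    (hB : B = Matrix.of fun r s : Fin n =>
      (Mod4.hankelT n (Function.update q 0 0) - q n • (1 : Matrix (Fin (n + 1)) (Fin (n + 1)) ℂ)) ⟨0 + r, by omega⟩
        ⟨0 + 1 + s, by omega⟩)
    {Hsq : Matrix (Fin (n + 1)) (Fin (n + 1)) ℂ} (hHsq : Hsq = Matrix.of fun i j : Fin (n + 1) => q ((i : ℕ) + (j : ℕ)))
    (hH : Hsq.det ≠ 0)
    (hdet : B.det ≠ 0) :
    (∑ k ∈ Finset.range (n + n + 1), (-1 : ℤ) ^ k * (finrank ℂ ↥(S ℂ (hodgeZeroOne hA) k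
        ((∑ m ∈ Finset.range (n + n + 1), (q m * ((m.factorial : ℕ) : ℂ)⁻¹) •
            ((⋀[ℂ]^2 (complexBetti A.X 1)).subtype ((abelianVarietyCohomologyExteriorH1_holds.equiv A 2).symm h)) ^ m) +
          (⋀[ℂ]^(2 * n) (complexBetti A.X 1)).subtype ((abelianVarietyCohomologyExteriorH1_holds.equiv A (2 * n)).symm cP) +
          (⋀[ℂ]^(2 * n) (complexBetti A.X 1)).subtype ((abelianVarietyCohomologyExteriorH1_holds.equiv A (2 * n)).symm cQ))) : ℤ)) =
      (-1 : ℤ) ^ n * (2 * ((n + n - 2).choose (n - 1) : ℤ) + 2 * n + 2) := by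
  haveI : Module.Finite ℂ (complexBetti A.X 1) := abelianVarietyCohomologyExteriorH1_holds.finite_one A
  have hn : 2 ≤ n := by omega
  rw [show (2 * ((n + n - 2).choose (n - 1) : ℤ) + 2 * n + 2) = 2 * ((n + n - 2).choose (n - 1) : ℤ) + 2 * n + 2 - ((0 : ℕ) : ℤ)
    by push_cast; ring]
  have hq0' : ∀ m, 1 ≤ m → m < n → q m = 0 := hq

  have hn1 : 1 ≤ n := by omega
  have h0 := finrank_S_weilType_zero hA hdim hd hφ hP hQ hp hh h11 hvol hcP hcP0 hcQ hcQ0 hn1 q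
  have htop := finrank_S_weilType_top hA hdim hd hφ hP hQ hp hh h11 hvol hcP hcP0 hcQ hcQ0 hn1 q
  refine alternating_sum_leading_row hn _ _ ?_ ?_ ?_
  · intro k hk
    rcases Nat.eq_zero_or_pos k with rfl | hk1
    · rw [h0, Nat.choose_zero_right, Nat.choose_zero_right]
    · exact finrank_S_leading_deg hA hdim hd hφ hP hQ hp hh h11 hvol hcP hcP0 hcQ hcQ0 hq0' hqn hk1 hk
  · intro k hk
    rcases Nat.eq_zero_or_pos k with rfl | hk1
    · rw [Nat.sub_zero, htop, Nat.choose_zero_right, Nat.choose_zero_right]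
    · exact finrank_S_leading_deg_dual hA hdim hd hφ hP hQ hp hh h11 hvol hcP hcP0 hcQ hcQ0 hq0' hqn (k := n + n - k)
        (k' := k) hk1 hk (by omega)
  · exact finrank_S_idealShape_middle_pinZero_odd_of_ne hA hnk (by omega) hodd hdim hd hφ hP hQ hp hh h11 hvol hcP hcP0 hcQ hcQ0 hq
      hq0 hqn ht hpin hB hHsq hH hdet

end RealCarrier

end Summit.Ventures.HSemireg.WeilFrame

end
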